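import Literature.Combinatorics.SimpleGraph.ReducedDivisorsDhar
import Literature.Combinatorics.SimpleGraph.ChipFiringAcyclicOrientations
import HarnessLib

/-!
# `G`-parking functions: domination, the bound `‖f‖ ≤ |E| − |V|`, maximal = maximum, and the
# bijection between maximum `G`-parking functions and acyclic orientations with a unique source
# (Benson–Chakrabarty–Tetali 2010, Propositions 2.2–2.3, Theorem 3.1, Corollary 3.2)

Source (held, read at the page; statements VERBATIM). B. Benson, D. Chakrabarty, P. Tetali,
*`G`-parking functions, acyclic orientations and spanning trees*, Discrete Math. 310 (2010)
1340–1353 [BensonChakrabartyTetali2010] (held text `paper:arxiv-0801.1114`, chunks p0004–p0007).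
«**Definition 2.1.** For a connected graph `G`, a `G`-parking function relative to vertex `q ∈ G`
is a function `f : V(G) → ℤ_{≥ −1}` such that `f(q) = −1` and for every non-empty
`A ⊆ V(G) ∖ {q}`, there exists `v ∈ A` such that `0 ≤ f(v) < d_{Ā}(v)`, where `d_{Ā}(v)` is the
number of edges `e = vw` with `w ∉ A`. […] **Definition 2.2.** Given two parking functions
`f, g ∈ 𝒫(G,q)`, we say `g ≺ f`, if `g(v) ≤ f(v)`, for all `v ∈ V`. The maximal elements in this
partial order will be referred to as maximal parking functions. Finally, a parking function with
the largest sum is called a maximum parking function. For `f ∈ 𝒫(G,q)`, let `‖f‖ := Σ_v f(v)`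
[…] **Proposition 2.2.** (a) Let `f ∈ 𝒫(G,q)`, and suppose `g : V(G) → ℤ_{≥−1}` such that
`g(q) = −1` and `0 ≤ g(v) ≤ f(v)`, for `v ∈ G` with `v ≠ q`. Then `g ∈ 𝒫(G,q)`. (b) If
`f, g ∈ 𝒫(G,q)`, then `f ∧ g ∈ 𝒫(G,q)` […] **Proposition 2.3.** For every connected graph
`G = (V,E)`, every `f ∈ 𝒫(G,q)`, we have `‖f‖ ≤ |E| − |V|`. More over, the equality is always
achieved. […] where we also used the fact that `f(v) ≤ d(v) − 1`, for every `v` and parking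
function `f`. […] Let `𝒜(G,q)` be the set of acyclic orientations of `G` with a unique source at
vertex `q`. Finally, let `MP(G,q)` denote the set of maximum `G`-parking functions.
**Theorem 3.1.** There exists a bijection between `𝒜(G,q)` and the set `MP(G,q)` of maximum
`G`-parking functions. Given an acyclic orientation `𝒪 ∈ 𝒜(G,q)` with a unique source at `q`,
define the function `f = f(𝒪)` on the vertices of `G`: let `f(v)` be the indegree (in `𝒪`) of `v`
minus 1. […] **Corollary 3.2.** Every maximal parking function is a maximum parking function.
This follows from the proof of correctness of the Extended Dhar algorithm described above – if
`f` were maximal, but not maximum, then there must be a vertex in Dhar's marking whose indegree is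
at least `f(v) + 2`. But then we can increase `f(v)` by one, and obtain a valid parking function,
contradicting the maximality of `f`.»

## What is formalised (B–N / B–S vocabulary of the tree: a `G`-parking function relative to `q` IS
## a `q`-reduced divisor `D` (`IsReduced G q D` of `ReducedDivisors`) with the convention
## `D(q) = −1`; `ν_P = orderDivisor`; `g = genus G = |E| − |V| + 1`; acyclic orientations with
## unique source `q` as in the lineage's `ChipFiringAcyclicOrientations` / Godsil–Royle §14.12)

* «`f(v) ≤ d(v) − 1`»: `IsReduced.apply_le_degree_sub_one`; **Proposition 2.2** (a)
  `IsReduced.of_le` (domination), (b) `IsReduced.inf` (`f ∧ g`);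
* **Proposition 2.3** `IsReduced.sum_erase_le` (`Σ_{v ≠ q} D(v) ≤ |E| − |V| + 1`, i.e.
  `‖f‖ ≤ |E| − |V|` with `f(q) = −1`), `IsReduced.sum_sub_genus_le_apply` (so
  `deg D − g ≤ D(q)`), and «the equality is always achieved»
  `exists_isReduced_sum_erase_eq`; the mechanism: `isReduced_orderDivisor_of_forall_exists`
  (for an order in which every `v ≠ q` has an earlier neighbour, `ν_P` is `q`-reduced) and
  **`IsReduced.exists_le_orderDivisor_isReduced`** (Dhar's burning order of `f` yields a MAXIMUM
  parking function `ν_P` dominating `f`);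
* **Corollary 3.2** `IsReduced.sum_erase_eq_of_maximal` (maximal ⟹ maximum);
* **Theorem 3.1** **`card_maximum_eq_card_acyclicOrientations`**
  (`|MP(G,q)| = |𝒜(G,q)|`), through `D ↦ K⁺ − D` (`ReducedDivisorsDhar`) and Godsil–Royle's
  Lemma 14.12.1 in the tree (`card_isQCritical_eq`); `IsQCritical.apply_eq_degree_of_sum_eq`
  (a `q`-critical state with `m` chips has exactly `d(q)` on `q`).

Theorems only; no `sorry`; no named facts.
-/

open Finset SimpleGraph Matrix
open Literature.Combinatorics.SimpleGraph.ChipFiring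
open Literature.Combinatorics.SimpleGraph.ChromaticPolynomial

namespace Literature.Combinatorics.SimpleGraph.BakerNorine

variable {V : Type*} [Fintype V] [DecidableEq V] {G : SimpleGraph V} [DecidableRel G.Adj]

/-! ### §1 Parking functions: pointwise bounds and domination -/

section Domination

/-- «we also used the fact that `f(v) ≤ d(v) − 1`, for every `v` and parking function `f`»
(take `A = {v}`). [cite: BensonChakrabartyTetali2010, Proposition 2.3 (proof)] -/
theorem IsReduced.apply_le_degree_sub_one {q : V} {D : V → ℤ} (hD : IsReduced G q D) {v : V}
    (hv : v ≠ q) : D v ≤ G.degree v - 1 := by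
  obtain ⟨w, hw, hlt⟩ := hD.2 {v} (Finset.singleton_nonempty v) (by simpa using hv.symm)
  rw [Finset.mem_singleton] at hw
  subst hw
  have : #(G.neighborFinset w \ {w}) ≤ G.degree w := by
    rw [← card_neighborFinset_eq_degree]
    exact Finset.card_le_card Finset.sdiff_subset
  omega

/-- **Proposition 2.2 (a)** (domination): «Let `f ∈ 𝒫(G,q)`, and suppose […]
`0 ≤ g(v) ≤ f(v)`, for `v ∈ G` with `v ≠ q`. Then `g ∈ 𝒫(G,q)`.»
[cite: BensonChakrabartyTetali2010, Proposition 2.2 (a)] -/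
theorem IsReduced.of_le {q : V} {D D' : V → ℤ} (hD : IsReduced G q D) (h0 : ∀ v, v ≠ q → 0 ≤ D' v)
    (hle : ∀ v, v ≠ q → D' v ≤ D v) : IsReduced G q D' := by
  refine ⟨h0, fun A hA hqA => ?_⟩
  obtain ⟨v, hv, hlt⟩ := hD.2 A hA hqA
  exact ⟨v, hv, (hle v fun h => hqA (h ▸ hv)).trans_lt hlt⟩

/-- **Proposition 2.2 (b)**: «If `f, g ∈ 𝒫(G,q)`, then `f ∧ g ∈ 𝒫(G,q)`» (pointwise minimum).
[cite: BensonChakrabartyTetali2010, Proposition 2.2 (b)] -/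
theorem IsReduced.inf {q : V} {D D' : V → ℤ} (hD : IsReduced G q D) (hD' : IsReduced G q D') :
    IsReduced G q (D ⊓ D') :=
  hD.of_le (fun _ hv => le_inf (hD.nonneg hv) (hD'.nonneg hv)) fun _ _ => inf_le_left

end Domination

/-! ### §2 Proposition 2.3: `‖f‖ ≤ |E| − |V|`, with equality achieved -/

section Bound

/-- For an order in which every vertex `v ≠ q` has an earlier neighbour (as in Dhar's marking
from `q`), `ν_P` is a `G`-parking function: `q`-reduced («a vertex `v` […] becomes a source only
when all its `f(v) + 1` in-neighbors have been marked»).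
[cite: BensonChakrabartyTetali2010, Theorem 3.1 (proof)] -/
theorem isReduced_orderDivisor_of_forall_exists (q : V) (ρ : V → ℕ)
    (hconn : ∀ v, v ≠ q → ∃ w, G.Adj v w ∧ ρ w < ρ v) : IsReduced G q (orderDivisor G ρ) := by
  refine isReduced_of_forall_lt_card ρ (fun v hv => ?_) fun v _ => ?_
  · obtain ⟨w, hvw, hw⟩ := hconn v hv
    rw [orderDivisor_apply]
    have : 1 ≤ #{u ∈ G.neighborFinset v | ρ u < ρ v} :=
      Finset.card_pos.2 ⟨w, Finset.mem_filter.2 ⟨(mem_neighborFinset G v w).2 hvw, hw⟩⟩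
    omega
  · rw [orderDivisor_apply]
    omega

/-- **Dhar's order dominates by a maximum parking function**: for a `q`-reduced `D` there is a
linear order from `q`, each later vertex having an earlier neighbour, with `D ≤ ν_P` off `q`,
`ν_P` itself `q`-reduced and `Σ_{v ≠ q} ν_P(v) = g` («if `f` were maximal, but not maximum, then
there must be a vertex in Dhar's marking whose indegree is at least `f(v) + 2`»).
[cite: BensonChakrabartyTetali2010, Corollary 3.2 (proof) and Proposition 2.3] -/
theorem IsReduced.exists_le_orderDivisor_isReduced {q : V} {D : V → ℤ} (hD : IsReduced G q D) :
    ∃ ρ : V → ℕ, Function.Injective ρ ∧ ρ q = 0 ∧ (∀ v, v ≠ q → D v ≤ orderDivisor G ρ v) ∧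
      IsReduced G q (orderDivisor G ρ) ∧ orderDivisor G ρ q = -1 ∧
      ∑ v ∈ univ.erase q, orderDivisor G ρ v = genus G := by
  obtain ⟨h0, ρ, hρ, hq, hburn⟩ := isReduced_iff_exists_burningOrder.1 hD
  have hconn : ∀ v, v ≠ q → ∃ w, G.Adj v w ∧ ρ w < ρ v := fun v hv => by
    have h1 := hburn v hv
    have h2 := h0 v hv
    have : 0 < #{w ∈ G.neighborFinset v | ρ w < ρ v} := by omega
    obtain ⟨w, hw⟩ := Finset.card_pos.1 this
    rw [Finset.mem_filter, mem_neighborFinset] at hw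
    exact ⟨w, hw.1, hw.2⟩
  have hνq : orderDivisor G ρ q = -1 := by
    rw [orderDivisor_apply]
    have : #{w ∈ G.neighborFinset q | ρ w < ρ q} = 0 :=
      Finset.card_eq_zero.2 (Finset.filter_eq_empty_iff.2 fun w _ => by rw [hq]; omega)
    rw [this]
    rfl
  refine ⟨ρ, hρ, hq, fun v hv => ?_, isReduced_orderDivisor_of_forall_exists q ρ hconn, hνq, ?_⟩
  · have := hburn v hv
    rw [orderDivisor_apply]
    omega
  · have h := sum_orderDivisor G hρ
    rw [← Finset.add_sum_erase _ _ (mem_univ q), hνq] at h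
    linarith

/-- **Proposition 2.3.** «For every connected graph `G = (V,E)`, every `f ∈ 𝒫(G,q)`, we have
`‖f‖ ≤ |E| − |V|`» — with `f(q) = −1`, i.e. `Σ_{v ≠ q} f(v) ≤ |E| − |V| + 1 = g`.
[cite: BensonChakrabartyTetali2010, Proposition 2.3] -/
theorem IsReduced.sum_erase_le {q : V} {D : V → ℤ} (hD : IsReduced G q D) :
    ∑ v ∈ univ.erase q, D v ≤ genus G := by
  obtain ⟨ρ, -, -, hle, -, -, hsum⟩ := hD.exists_le_orderDivisor_isReduced
  rw [← hsum]
  exact Finset.sum_le_sum fun v hv => hle v (Finset.ne_of_mem_erase hv)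

/-- Hence a `q`-reduced divisor carries at least `deg(D) − g` dollars at `q` (and `|D| ≠ ∅` as soon
as `deg(D) ≥ g` — Baker–Norine's Theorem 1.9 (1) once more).
[cite: BensonChakrabartyTetali2010, Proposition 2.3] -/
theorem IsReduced.sum_sub_genus_le_apply {q : V} {D : V → ℤ} (hD : IsReduced G q D) :
    ∑ v, D v - genus G ≤ D q := by
  have h := hD.sum_erase_le
  rw [← Finset.add_sum_erase _ _ (mem_univ q)]
  linarith

/-- **Proposition 2.3, «the equality is always achieved»**: some `G`-parking function has
`Σ_{v ≠ q} f(v) = |E| − |V| + 1` (`G` connected). [cite: BensonChakrabartyTetali2010, Proposition 2.3] -/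
theorem exists_isReduced_sum_erase_eq (hG : G.Connected) (q : V) :
    ∃ D : V → ℤ, IsReduced G q D ∧ D q = -1 ∧ ∑ v ∈ univ.erase q, D v = genus G := by
  obtain ⟨D₀, -, hD₀⟩ := exists_isReduced hG q 0
  obtain ⟨ρ, -, -, -, hred, hq, hsum⟩ := hD₀.exists_le_orderDivisor_isReduced
  exact ⟨orderDivisor G ρ, hred, hq, hsum⟩

/-- **Corollary 3.2.** «Every maximal parking function is a maximum parking function»: a
`q`-reduced divisor not strictly dominated off `q` by another `q`-reduced divisor has
`Σ_{v ≠ q} D(v) = g`. [cite: BensonChakrabartyTetali2010, Corollary 3.2] -/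
theorem IsReduced.sum_erase_eq_of_maximal {q : V} {D : V → ℤ} (hD : IsReduced G q D)
    (hmax : ∀ D' : V → ℤ, IsReduced G q D' → (∀ v, v ≠ q → D v ≤ D' v) → ∀ v, v ≠ q → D' v ≤ D v) :
    ∑ v ∈ univ.erase q, D v = genus G := by
  obtain ⟨ρ, -, -, hle, hred, -, hsum⟩ := hD.exists_le_orderDivisor_isReduced
  rw [← hsum]
  exact Finset.sum_congr rfl fun v hv =>
    le_antisymm (hle v (Finset.ne_of_mem_erase hv))
      (hmax _ hred hle v (Finset.ne_of_mem_erase hv))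

end Bound

/-! ### §3 Theorem 3.1: maximum parking functions and acyclic orientations with source `q` -/

section Orientations

/-- A `q`-critical state with the minimum number `m = |E(G)|` of chips has exactly `d(q)` chips
on `q`. [cite: GodsilRoyle2001, Lemma 14.12.1 and Lemma 14.12.3, held godsilnd chunk p0312] -/
theorem _root_.Literature.Combinatorics.SimpleGraph.ChipFiring.IsQCritical.apply_eq_degree_of_sum_eq
    (hG : G.Connected) {q : V} {s : V → ℤ} (hs : IsQCritical G q s)
    (hsum : ∑ v, s v = #G.edgeFinset) : s q = G.degree q := by
  have h1 := (canFire_iff G s q).1 (hs.canFire G hG)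
  have h2 := (hs.with_degree G hG).card_edgeFinset_le_sum G hG
  simp only [Pi.add_apply, Finset.sum_add_distrib, Finset.sum_pi_single', mem_univ, if_true,
    hsum] at h2
  omega

omit [DecidableEq V] in
/-- For a `G`-parking function (`D(q) = −1`), `K⁺ − D` already has `d(q)` chips on `q`.
[cite: BakerShokrieh2013, §5.2] -/
theorem bnDual_apply_base_of_eq_neg_one {q : V} {D : V → ℤ} (hq : D q = -1) :
    bnDual G D q = G.degree q := by
  rw [bnDual_apply, hq]
  ring

/-- **Theorem 3.1.** «There exists a bijection between `𝒜(G,q)` and the set `MP(G,q)` of maximum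
`G`-parking functions» (`G` connected): the maximum `G`-parking functions relative to `q`
(`q`-reduced, `D(q) = −1`, `‖D‖ = |E| − |V|`) are equinumerous with the acyclic orientations of
`G` whose unique source is `q`. Route: `D ↦ K⁺ − D` is a bijection onto the `q`-critical states
with `m` chips (`ReducedDivisorsDhar`), which correspond to these orientations by Godsil–Royle's
Lemma 14.12.1 (the tree's `card_isQCritical_eq`).
[cite: BensonChakrabartyTetali2010, Theorem 3.1] -/
theorem card_maximum_eq_card_acyclicOrientations (hG : G.Connected) (q : V) :
    Nat.card {D : V → ℤ // IsReduced G q D ∧ D q = -1 ∧ ∑ v, D v = genus G - 1} =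
      Nat.card {o : V → V → Prop //
        IsAcyclicOrientation G o ∧ ∀ v, (∀ w, G.Adj v w → o v w) ↔ v = q} := by
  rw [← card_isQCritical_eq G hG q]
  refine Nat.card_congr
    { toFun := fun D => ⟨bnDual G D.1, ?_, ?_⟩
      invFun := fun s => ⟨bnDual G s.1, ?_, ?_, ?_⟩
      left_inv := fun D => Subtype.ext (bnDual_bnDual G D.1)
      right_inv := fun s => Subtype.ext (bnDual_bnDual G s.1) }
  · -- `K⁺ − D` is `q`-critical (its value at `q` is already `d(q)`)
    have h := (isReduced_iff_isQCritical hG).1 D.2.1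
    rwa [← bnDual_apply_base_of_eq_neg_one (G := G) D.2.2.1, Function.update_eq_self] at h
  · rw [sum_bnDual, D.2.2.2, genus_eq]
    ring
  · -- `K⁺ − s` is `q`-reduced
    have hsq := s.2.1.apply_eq_degree_of_sum_eq hG s.2.2
    rw [isReduced_iff_isQCritical hG, bnDual_bnDual, ← hsq, Function.update_eq_self]
    exact s.2.1
  · rw [bnDual_apply, s.2.1.apply_eq_degree_of_sum_eq hG s.2.2]
    ring
  · rw [sum_bnDual, s.2.2, genus_eq]
    ring

end Orientations

end Literature.Combinatorics.SimpleGraph.BakerNorine
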